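import Summits.Ventures.PercRepro.Night2BasisBlocking

/-!
# night-2: the levels of the targets above `Q ∪ X`

Counting tools for the blocking sum (`basis_pair_fair_of_blocking_sum`): the targets above `Q ∪ X` at level `j`
(`|T ∖ Q| = j`) are the sets `Q ∪ X ∪ Y′` with `Y′` a `(j − |X|)`-subset of `(G ∖ Q) ∖ X`, so there are at least
`C(|G ∖ Q| − |X|, j − |X|)` of them (`choose_le_card_targets_level`, an injection; the count is exact), and
`capS T = 1` at the top four levels (`capS_eq_one_of_card_sdiff_le_three`, from `k1_eq_zero_of_rkN_sdiff_le_three`).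
Paper `proofs/NIGHT-2-g32.md` §3.3.
-/

namespace PercRepro.Shadow

open PercRepro.ThmH PercRepro.PerFlat

variable {α : Type*} [DecidableEq α] {M : Matroid α} [M.Finite] {G : Finset α}

/-- `capS T = 1` when at most three points of `G` are off `T`. -/
theorem capS_eq_one_of_card_sdiff_le_three (hd : (gr M \ G).card = 2) {T : Finset α}
    (h3 : (G \ T).card ≤ 3) : capS M 5 G T = 1 :=
  capS_eq_one_of_rkN_sdiff_le_three hd (le_trans (rkN_le_card _) h3)

/-- **The targets above `Q ∪ X` at level `j` number at least `C(|G ∖ Q| − |X|, j − |X|)`**: the sets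
`Q ∪ X ∪ Y′` for the `(j − |X|)`-subsets `Y′` of `(G ∖ Q) ∖ X` are distinct targets with `|T ∖ Q| = j`. -/
theorem choose_le_card_targets_level (hG : G ∈ flatsQ M (5 + 1)) {B : Finset α} (hB : B ∈ thinMembers M 5 G)
    {z : α} (hz : z ∈ G \ clF M B) {X : Finset α} (hX : X ⊆ G \ insert z B) {j : ℕ} (hj : 1 ≤ j)
    (hjX : X.card ≤ j) :
    ((G \ insert z B).card - X.card).choose (j - X.card) ≤
      ((tgtSets M 5 G B z).filter (fun T => X ⊆ T ∧ (T \ insert z B).card = j)).card := by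
  have hBm : B ∈ membersIn M (Uq M (5 + 2) 5) G := (mem_thinMembers.1 hB).1
  rw [← Finset.card_sdiff_of_subset hX, ← Finset.card_powersetCard]
  apply Finset.card_le_card_of_injOn (fun Y' => insert z B ∪ (X ∪ Y'))
  · intro Y' hY'
    rw [Finset.mem_coe, Finset.mem_powersetCard] at hY'
    obtain ⟨hY'sub, hY'card⟩ := hY'
    have hXY' : X ∪ Y' ⊆ G \ insert z B :=
      Finset.union_subset hX (hY'sub.trans Finset.sdiff_subset)
    have hdisj : Disjoint X Y' := Finset.disjoint_of_subset_right hY'sub Finset.disjoint_sdiff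
    have hcardXY : (X ∪ Y').card = j := by
      rw [Finset.card_union_of_disjoint hdisj, hY'card]
      omega
    rw [Finset.mem_coe, Finset.mem_filter]
    refine ⟨?_, Finset.subset_union_left.trans Finset.subset_union_right, ?_⟩
    · rw [tgtSets_eq_image hG hBm hz, Finset.mem_image]
      refine ⟨X ∪ Y', Finset.mem_filter.2 ⟨Finset.mem_powerset.2 hXY', ?_⟩, rfl⟩
      rw [← Finset.card_pos, hcardXY]
      omega
    · rw [Finset.union_sdiff_left, Finset.sdiff_eq_self_of_disjoint
        (Finset.disjoint_of_subset_left hXY' Finset.sdiff_disjoint), hcardXY]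
  · intro Y₁ hY₁ Y₂ hY₂ heq
    rw [Finset.mem_coe, Finset.mem_powersetCard] at hY₁ hY₂
    have key : ∀ Y', Y' ⊆ (G \ insert z B) \ X →
        ((insert z B ∪ (X ∪ Y')) \ insert z B) \ X = Y' := by
      intro Y' hY'
      have hXY' : X ∪ Y' ⊆ G \ insert z B :=
        Finset.union_subset hX (hY'.trans Finset.sdiff_subset)
      rw [Finset.union_sdiff_left, Finset.sdiff_eq_self_of_disjoint
        (Finset.disjoint_of_subset_left hXY' Finset.sdiff_disjoint), Finset.union_sdiff_left,
        Finset.sdiff_eq_self_of_disjoint (Finset.disjoint_of_subset_left hY' Finset.sdiff_disjoint)]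
    have h1 := key Y₁ hY₁.1
    have h2 := key Y₂ hY₂.1
    simp only at heq
    rw [← h1, ← h2, heq]

end PercRepro.Shadow
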